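import Summits.QuantumFields.YangMills.Theorems.MirrorModularBoostsHypercubicLimitClosureHalvesDefs
import Literature.MathematicalPhysics.QuantumFieldTheory.WilsonAxisSymmetry

/-!
# Crux `WeakCouplingHypercubicLimitRP` (stmt-QuantumFields-27398), line `Sketch`, door B, R1-side:
# the diagonal clustering letter `DiagCluster` (Defs)

Definitions file (`--supports stmt-QuantumFields-27398 --as helper`) of the crux lead `lead-27398-D1` g3 (docket director-ym
g24, O4 WORD 37 internal plan (p1); critic idea-crit-9 g13 verdict #115 PASS-WITH-PRICE): the TARGET of the Cauchy–Schwarz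
polarisation transport of idea card `Cruxes/WeakCouplingHypercubicLimitRP/Ideas/axis-diagonal-polarisation-transport.md`
(cruxidea-10604-r2 seat `spectral-transfer`, Sketch §2), typed VERBATIM:

* `diagBox T` — the closed lattice box `{1 ≤ x₀ ≤ T, −T ≤ x₁ ≤ −1}` of links of `ℤ⁴` (endpoints included), inside the open
  half-space `{x₁ < x₀}` of the swap mirror AND inside the axis slab `{1 ≤ x₀ ≤ T}` of `RPSpectral`;
* `DiagCluster r sch Δ C` — relative clustering ALONG THE DIAGONAL `d = e₀ − e₁` with the SWAP mirror
  (`configPerm (Equiv.swap 0 1)`), on every torus of side `2S+1 ≥ 2L_k+1`, for bounded box-local functionals: `n` diagonal steps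
  (shift `−n e₀ + n e₁`, AWAY from the mirror, `configShift v U e = U (e.1 − v, e.2)`) cost `e^{−Δ a_k n}` RELATIVE to the variance,
  plus the thermal floor `C B² e^{−Δ a_k S}` — the same constants `(Δ, C)` as the axis letter
  `RPSpectral r sch Δ C` (✓ `…MirrorModularBoostsHypercubicLimitClosureHalvesDefs`), room `2(2T+n+3) ≤ S`.

The companion proof file `…PencilRigidityWeakCouplingHypercubicLimitRPDiagClusterOfRPSpectral` proves
`RPSpectral r sch Δ C → DiagCluster r sch Δ C` (`0 ≤ Δ`, `β_k ≥ 0` eventually).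

HONEST FRAMING: vocabulary only.  `DiagCluster` is a clustering INEQUALITY for box-local functionals (never a positivity of
the swap pairing, which fails at every finite `k`); it is a PREDICATE on `(r, sch, Δ, C)`, not a cited fact and not a registered
obligation.  D1′, the crux ⟨27398⟩ and its heart S6i are OPEN; the Yang–Mills mass gap is NOT proved here or anywhere in the
tree.  No instance, no notation, `autoImplicit false`.

References: Osterwalder–Seiler, Ann. Phys. 110 (1978) §2; Fröhlich–Israel–Lieb–Simon, CMP 62 (1978) Thm 2.1; Glimm–Jaffe (1987)
§6.1 (polarisation of the reflection-positive form).
-/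

set_option autoImplicit false

noncomputable section

open MeasureTheory Filter Topology
open Literature.MathematicalPhysics.QuantumLattice Literature.MathematicalPhysics.AQFT
  Literature.MathematicalPhysics.QuantumFieldTheory

namespace Summit.QuantumFields.YangMills.Cruxes.DiagonalMirrorRPR.SpectralTransfer

variable {G : Type} [Group G] [TopologicalSpace G] [IsTopologicalGroup G] [CompactSpace G]
  [MeasurableSpace G] [BorelSpace G]

/-- The closed lattice box `{1 ≤ x₀ ≤ T, −T ≤ x₁ ≤ −1}` (as a set of links of `ℤ⁴`, endpoints included) — inside the open
half-space `{x₁ < x₀}` AND inside the axis slab `{1 ≤ x₀ ≤ T}` of `RPSpectral`; its swap image lies in `{x₀ ≤ −1}`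
(Sketch §2 of the idea card `axis-diagonal-polarisation-transport`, verbatim). -/
def diagBox (T : ℕ) : Set (Literature.MathematicalPhysics.QuantumLattice.ZdEdge 4) :=
  {e | 1 ≤ e.1 0 ∧ e.1 0 + (if e.2 = 0 then 1 else 0) ≤ T ∧
       -(T : ℤ) ≤ e.1 1 ∧ e.1 1 + (if e.2 = 1 then 1 else 0) ≤ -1}

/-- **`DiagCluster r sch Δ C`** — relative clustering along the diagonal `d = e₀ − e₁` with the SWAP mirror, on every torus
at least the scheme's own (`side 2S+1`, `L_k ≤ S`), for bounded box-local functionals: `n` diagonal steps cost `e^{−Δ a_k n}`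
RELATIVE to the variance, plus the thermal floor `C B² e^{−Δ a_k S}` (shift sign convention as in `RPSpectral`: the support
moves AWAY from the mirror).  Verbatim Sketch §2 of the idea card `axis-diagonal-polarisation-transport`; a PREDICATE on
`(r, sch, Δ, C)` (the line's R1-side letter target), not a cited fact. -/
def DiagCluster (r : LatticeRep G) (sch : SpeciesScheme (YMSpecies G)) (Δ C : ℝ) : Prop :=
  ∀ᶠ k in atTop, ∀ (S T n : ℕ), sch.L k ≤ S → 2 * (2 * T + n + 3) ≤ S →
    ∀ (Y : LGConfig 4 G → ℝ) (B : ℝ), Measurable Y → (∀ U, |Y U| ≤ B) → DependsOn Y (diagBox T) →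
      |(∫ U, Y (torusLift (2 * S + 1) (configPerm (Equiv.swap (0 : Fin 4) 1) U)) *
            Y (configShift (-Pi.single 0 (n : ℤ) + Pi.single 1 (n : ℤ)) (torusLift (2 * S + 1) U))
          ∂(wilsonMeasure r.ρ (sch.β k) : Measure (GaugeConfig 4 (2 * S + 1) G))) -
        (∫ U, Y (torusLift (2 * S + 1) U)
          ∂(wilsonMeasure r.ρ (sch.β k) : Measure (GaugeConfig 4 (2 * S + 1) G))) ^ 2| ≤
        Real.exp (-(Δ * sch.a k * n)) *
          ((∫ U, (Y (torusLift (2 * S + 1) U)) ^ 2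
              ∂(wilsonMeasure r.ρ (sch.β k) : Measure (GaugeConfig 4 (2 * S + 1) G))) -
            (∫ U, Y (torusLift (2 * S + 1) U)
              ∂(wilsonMeasure r.ρ (sch.β k) : Measure (GaugeConfig 4 (2 * S + 1) G))) ^ 2) +
        C * B ^ 2 * Real.exp (-(Δ * sch.a k * S))

end Summit.QuantumFields.YangMills.Cruxes.DiagonalMirrorRPR.SpectralTransfer

end
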